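import Literature.AlgebraicGeometry.ComplexMultiplication.CyclotomicFermatCMTypesRemarkTwoEllipticFactors
import Literature.AlgebraicGeometry.ComplexMultiplication.CyclotomicFermatCMTypesFixedFieldOfStabilizer
import HarnessLib

/-!
# The CM fields of Koblitz's elliptic Fermat factors at the levels `15, 20, 22, 39`: `ℚ(√−15)`, `ℚ(√−5)`, `ℚ(√−11)`, `ℚ(√−39)` as Gauss
# periods in `ℚ(ζ_N)` — Koblitz–Rohrlich's «fixed field of `W_{r,s}`» made explicit, and Remark 2's level-`39` curve «that does not occur as a
# simple factor for prime `N`» identified: complex multiplication by `ℚ(√−39)`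

Layer `Literature/AlgebraicGeometry/ComplexMultiplication`; sequel of `CyclotomicFermatCMTypesRemarkTwoEllipticFactors` (gen 36: `2|W| = φ(N)` ⟹
`A ∼ E^{|W|}` with `E` a CM elliptic curve, `[K₁ : ℚ] = 2`, `Gal(ℚ(ζ_N)/K₁) = {u | a(u) ∈ W}`; `N = 21`: `K₁ ⊆ ℚ(ζ₇)`; `N = 39`: `K₁ ⊄ ℚ(ζ₁₃)`,
`K₁ ⊄ ℚ(ζ₃)` — honest column: «the identification `K₁ = ℚ(√−7)` (Gauss sum) … NOT typed»), of `CyclotomicFermatCMTypesFixedFieldOfStabilizer`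
(gen 41: `W` cyclic generated by `a(σ)` ⟹ `K₁ = ℚ(ζ_N)^σ`; `N = 7`: `K₁ = ℚ(√−7) = ℚ(1 + 2(ζ+ζ²+ζ⁴))`) and of
`CyclotomicFermatCMTypesKoblitzEllipticLevels` (this lane gen 42: at each level of Koblitz's list «{3,4,6,7,8,12,15,16,18,20,21,22,24,30,39,40,48,60}»
quoted by Bauer–Coste–Itzykson–Ruelle §3.4 an explicit primitive triple with `H` a GROUP: `15:(1,2,12)` `H = {1,2,4,8}`, `20:(1,1,18)`
`{1,3,7,9}`, `22:(1,3,18)` `{1,3,5,9,15}`, `39:(1,16,22)` `{1,2,4,5,8,10,11,16,20,22,25,32}`; honest column: «the CM fields at `15, 20, 22, 30, 39,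
40, 48, 60` are not identified»).  THIS FILE identifies them at the four levels whose group `H` is the kernel of a PRIMITIVE odd quadratic
character — `15, 20, 22, 39` — by the classical Gauss-period computation inside `ℚ(ζ_N)`: `H` is cyclic, `K₁` is the fixed field of one
automorphism `σ_g`, the period `η = Σ_{h ∈ H} ζ^h` is fixed, and `(2η − 1)² = −15, −11, −39` resp. `η² = −5`.  THEOREMS ONLY (no definition, no
named fact, no `sorry`; kernel `decide` for residue tables modulo `15, 20, 22, 39`; the period identities by `linear_combination` from
`ζ^N = 1` and the cyclotomic relations `Φ₃(ζ^{N/3}) = 0`, `Φ₅(ζ³) = 0`, `Φ₁₁(ζ²) = 0`, `Φ₁₃(ζ³) = 0`, `Φ₂₀(ζ) = 0` derived in place).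

THE SOURCES.  N. Koblitz, D. Rohrlich, Canad. J. Math. **30** (1978), §1 p. 1184 (held `paper:koblitz1978-simple-factors-jacobian-fermat-curve`):
«These factors have complex multiplication by an order of the fixed field of `W_{r,s}` and CM-type equal to `H_{r,s}/W_{r,s}`»; §2 Remark 2
(p. 1193): «For `N = 39`, `J_{1,16,22}` is isogenous to a product of `12` copies of an elliptic curve that does not occur as a simple factor for
prime `N`».  M. Bauer, A. Coste, C. Itzykson, P. Ruelle, J. Geom. Phys. **22** (1997), §3.3 p. 14 (held `paper:arxiv-hep-th_9604104`): «Let `K` be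
the subfield of `ℚ(ζ_{n₀})` fixed by `W_{r,s,t}` … The lattice within the curly brackets has complex multiplication by `K`»; worked example «for
`n = 7` … the subfield of `ℚ(ζ₇)` fixed by `σ₂` and `σ₄`, is `K = ℚ(√−7)`»; §3.4 p. 14 (Koblitz's list).  L. C. Washington, *Introduction to
Cyclotomic Fields*, Thm. 2.5 (`Gal(ℚ(ζ_N)/ℚ) ≅ (ℤ/N)ˣ`, `σ_a : ζ ↦ ζ^a`) and Ch. 2 (roots of unity) for the arithmetic.  The four field
identifications themselves are OURS (kernel), obtained by the sources' recipe; none of the sources prints `√−15`, `√−5`, `√−11`, `√−39`.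

READING (as in the siblings).  `W = W(S_Φ)` the residue stabiliser (the `Finset.filter` expression); «`K`» = the field `K₁` of ANY primitive
sub-pair `(K₁, Φ₁)` inducing `Φ`; a statement «`W = H` ⟹ `K₁ = ℚ(δ)`» is about EVERY CM type of `ℚ(ζ_N)` with that stabiliser (in particular
the Koblitz–Rohrlich type `Φ_{H_τ}` of the witness triple, for which `W = H_τ = H`).

## What is proved

* §0 (any `N`): `finrank_eq_two_of_two_mul_card_eq` (`2|W| = φ(N)` ⟹ `[K₁ : ℚ] = 2`); private `eq_adjoin_of_mem_of_sq_eq_neg`.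
* §1 `N = 20`, `H = {1,3,7,9} = ⟨3⟩`, **`ℚ(√−5)`**: `zetaOf_pow_ten_twenty` (`ζ¹⁰ = −1`), **`cyclotomic_relation_twenty`** (`Φ₂₀(ζ) = ζ⁸ − ζ⁶ + ζ⁴ − ζ² + 1
  = 0`), **`sq_period_twenty`** (`(ζ + ζ³ + ζ⁷ + ζ⁹)² = −5`), `apply_period_twenty` (`σ₃` fixes the period), `stabilizerResidues_twenty` (`W({1,3,7,9}) =
  {1,3,7,9}`, kernel), **`eq_adjoin_period_twenty`** (every CM type of `ℚ(ζ₂₀)` with `W = {1,3,7,9}`: `K₁ = ℚ(ζ+ζ³+ζ⁷+ζ⁹)`, `(·)² = −5`, `[K₁:ℚ] = 2`),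
  **`exists_isIsogeny_pow_four_elliptic_twenty`** (such `A` are fourfolds `∼ E⁴` `𝓞_{K₁}`-equivariantly, `E` ELLIPTIC with CM `𝓞_{K₁} → End E`,
  `K₁ = ℚ(√−5)` in this sense), `fermatCMType_twenty_one_one_eighteen` + **`exists_isIsogeny_pow_four_elliptic_fermat_twenty`** (the K–R type of
  `(1,1,18)`).
* §2 `N = 15`, `H = {1,2,4,8} = ⟨2⟩`, **`ℚ(√−15)`**: `cyclotomic_relations_fifteen` (`ζ¹⁰ + ζ⁵ + 1 = 0`, `ζ¹² + ζ⁹ + ζ⁶ + ζ³ + 1 = 0`),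
  **`sq_two_mul_period_sub_one_fifteen`** (`(2(ζ+ζ²+ζ⁴+ζ⁸) − 1)² = −15`), `apply_period_fifteen` (`σ₂`), `stabilizerResidues_fifteen`,
  **`eq_adjoin_period_fifteen`**, **`exists_isIsogeny_pow_four_elliptic_fifteen`**, `…_fermat_fifteen` (`(1,2,12)`).
* §3 `N = 22`, `H = {1,3,5,9,15} = ⟨3⟩`, **`ℚ(√−11)`**: `zetaOf_pow_eleven_twentyTwo` (`ζ¹¹ = −1`), `cyclotomic_relation_twentyTwo` (`Φ₁₁(ζ²) = 0`),
  **`sq_two_mul_period_sub_one_twentyTwo`** (`(2(ζ+ζ³+ζ⁵+ζ⁹+ζ¹⁵) − 1)² = −11`), `apply_period_twentyTwo`, `stabilizerResidues_twentyTwo`,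
  **`eq_adjoin_period_twentyTwo`**, **`exists_isIsogeny_pow_five_elliptic_twentyTwo`**, `…_fermat_twentyTwo` (`(1,3,18)`).
* §4 `N = 39`, `H = ⟨2⟩` of order `12`, **`ℚ(√−39)`** (K–R Remark 2): `cyclotomic_relations_thirtyNine` (`ζ²⁶ + ζ¹³ + 1 = 0`, `Φ₁₃(ζ³) = 0`),
  **`sq_two_mul_period_sub_one_thirtyNine`** (`(2η − 1)² = −39`, `η` the twelve-term period), `apply_period_thirtyNine` (`σ₂`),
  `stabilizerResidues_thirtyNine`, **`eq_adjoin_period_thirtyNine`**, **`exists_isIsogeny_pow_twelve_elliptic_sqrt_neg_thirtyNine`** (every `A` of a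
  type with `W = H`, in particular of `Φ_{H_{1,16,22}}`: `A ∼ E¹²`, `E` elliptic with CM by `𝓞_{K₁}`, `K₁ = ℚ(2η−1)`, `(2η−1)² = −39` — «an elliptic
  curve that does not occur as a simple factor for prime `N`»: its CM field `ℚ(√−39)` is not a subfield of any `ℚ(ζ_p)`... here: is `ℚ(δ)` with
  `δ² = −39`), `…_fermat_thirtyNine` (`(1,16,22)`).

## Honest column

(a) «`ℚ(√−d)`» is typed as the explicit subfield `ℚ(δ) ⊂ ℚ(ζ_N)` with `δ² = −d`, `[ℚ(δ) : ℚ] = 2`; rings of integers, class numbers (`h(−15) =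
h(−5) = 2`, `h(−39) = 4`) and the curves `E` up to isomorphism are not touched; `E` is determined up to isogeny.  (b) Levels `16, 18, 30, 40, 48, 60`
of the list have imprimitive characters (fields `ℚ(√−2)`, `ℚ(√−3)`, `ℚ(√−3)`, `ℚ(√−5)`, `ℚ(√−6)`, `ℚ(√−3)` from lower levels) and are not treated
here.  (c) Koblitz 1978 [kob] is not held; nothing here depends on it.  The Hodge conjecture is not proved and nothing here bears on it.
-/

noncomputable section

open NumberField

namespace Literature.AlgebraicGeometry.ComplexMultiplication

open CategoryTheory CategoryTheory.Limits
open Literature.AlgebraicGeometry.Motives (CMType AbelianVariety)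
open Literature.AlgebraicGeometry.Motives.AbelianVariety
open Literature.NumberTheory.ComplexMultiplication
open Literature.AlgebraicGeometry.HodgeTheory
open Literature.AlgebraicGeometry.Pohlmann1968 Literature.AlgebraicGeometry.Pohlmann1968.Cyclotomic
open CyclotomicCMTypeResidueSets (IsCMResidueSet unitResidues residueSet residueSet_cmTypeOfResidues isCMResidueSet_residueSet
  autResidue autResidue_spec exists_autResidue_eq)

/-! ## §0 Helpers at any level -/

section General

variable {N : ℕ} [NeZero N] {L : Type} [Field L] [NumberField L]

/-- A quadratic subfield containing a square root `δ` of a negative integer is `ℚ(δ)`. [folklore] -/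
private theorem eq_adjoin_of_mem_of_sq_eq_neg {K₁ : IntermediateField ℚ L} {δ : L} (hδ : δ ∈ K₁) {m : ℕ} (hm : 0 < m)
    (hsq : δ ^ 2 = -(m : L)) (hdeg : Module.finrank ℚ K₁ = 2) : K₁ = IntermediateField.adjoin ℚ {δ} := by
  have hle : IntermediateField.adjoin ℚ {δ} ≤ K₁ := IntermediateField.adjoin_simple_le_iff.2 hδ
  have hne : Module.finrank ℚ (IntermediateField.adjoin ℚ {δ}) ≠ 1 := by
    intro h1
    rw [IntermediateField.finrank_eq_one_iff, IntermediateField.adjoin_simple_eq_bot_iff, IntermediateField.mem_bot] at h1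
    obtain ⟨q, hq⟩ := h1
    have hq2 : (algebraMap ℚ L) (q ^ 2) = (algebraMap ℚ L) (-(m : ℚ)) := by
      rw [map_pow, hq, hsq, map_neg, map_natCast]
    have hq2' : q ^ 2 = -(m : ℚ) := (algebraMap ℚ L).injective hq2
    have hm' : (0 : ℚ) < m := by exact_mod_cast hm
    nlinarith [sq_nonneg q]
  haveI : FiniteDimensional ℚ K₁ := inferInstance
  have hdvd : Module.finrank ℚ (IntermediateField.adjoin ℚ {δ}) ∣ 2 := hdeg ▸ IntermediateField.finrank_dvd_of_le_right hle
  have h2 : Module.finrank ℚ (IntermediateField.adjoin ℚ {δ}) = 2 := by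
    rcases (Nat.dvd_prime Nat.prime_two).1 hdvd with h | h
    · exact absurd h hne
    · exact h
  exact (IntermediateField.eq_of_le_of_finrank_eq hle (h2.trans hdeg.symm)).symm

variable [IsCyclotomicExtension {N} ℚ L]

/-- **`2|W| = φ(N)` ⟹ `[K₁ : ℚ] = 2`**: the field of the primitive sub-pair is imaginary QUADRATIC when `H` is a group (`[ℚ(ζ_N) : K₁] = |W|`).
[cite: KoblitzRohrlich1978, §1 p. 1184] [cite: BauerCosteItzyksonRuelle1997, §3.4] -/
theorem finrank_eq_two_of_two_mul_card_eq (Φ : CMType L) {K₁ : IntermediateField ℚ L} (Φ₁ : CMType K₁)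
    (h₁ : inducedCMType (algebraMap K₁ L) Φ₁ = Φ)
    (hp₁ : ∀ s t : K₁ →+* ℂ,
      (∀ τ : ℂ ≃+* ℂ, (τ : ℂ →+* ℂ).comp s ∈ Φ₁.1 ↔ (τ : ℂ →+* ℂ).comp t ∈ Φ₁.1) → s = t)
    (hW : 2 * ((unitResidues N).filter fun t =>
        ∀ c ∈ unitResidues N, (c * t ∈ residueSet N Φ ↔ c ∈ residueSet N Φ)).card = N.totient) :
    Module.finrank ℚ K₁ = 2 := by
  have hmul := Module.finrank_mul_finrank ℚ K₁ L
  rw [finrank_eq_card_filter_of_primitive (N := N) Φ Φ₁ h₁ hp₁, finrank_eq_totient N L, ← hW] at hmul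
  have hpos : 0 < ((unitResidues N).filter fun t =>
      ∀ c ∈ unitResidues N, (c * t ∈ residueSet N Φ ↔ c ∈ residueSet N Φ)).card :=
    Finset.card_pos.2 ⟨1, one_mem_stabilizerResidues (N := N) Φ⟩
  exact Nat.eq_of_mul_eq_mul_right hpos hmul

end General

/-! ## §1 `N = 20`: `H = {1, 3, 7, 9}`, `K₁ = ℚ(ζ + ζ³ + ζ⁷ + ζ⁹) = ℚ(√−5)` -/

section Twenty

variable {L : Type} [Field L] [NumberField L] [IsCyclotomicExtension {20} ℚ L]

/-- `ζ²⁰ = 1`. [cite: Washington1997, Ch. 2 (roots of unity)] -/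
theorem zetaOf_pow_twenty : zetaOf 20 L ^ 20 = 1 := (IsCyclotomicExtension.zeta_spec 20 ℚ L).pow_eq_one

/-- `ζ¹⁰ = −1`. [cite: Washington1997, Ch. 2 (roots of unity)] -/
theorem zetaOf_pow_ten_twenty : zetaOf 20 L ^ 10 = -1 :=
  ((IsCyclotomicExtension.zeta_spec 20 ℚ L).pow (by norm_num) (show 20 = 10 * 2 by norm_num)).eq_neg_one_of_two_right

/-- **`Φ₂₀(ζ₂₀) = ζ⁸ − ζ⁶ + ζ⁴ − ζ² + 1 = 0`** (`x = ζ²` has `x⁵ = −1`, `x ≠ −1`). [cite: Washington1997, Ch. 2 (cyclotomic polynomials)] -/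
theorem cyclotomic_relation_twenty : zetaOf 20 L ^ 8 - zetaOf 20 L ^ 6 + zetaOf 20 L ^ 4 - zetaOf 20 L ^ 2 + 1 = 0 := by
  have hprim : IsPrimitiveRoot (zetaOf 20 L) 20 := IsCyclotomicExtension.zeta_spec 20 ℚ L
  have h4 : zetaOf 20 L ^ 4 ≠ 1 := hprim.pow_ne_one_of_pos_of_lt (by norm_num) (by norm_num)
  have hne : zetaOf 20 L ^ 2 + 1 ≠ 0 := by
    intro h
    apply h4
    have h2 : zetaOf 20 L ^ 2 = -1 := eq_neg_of_add_eq_zero_left h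
    rw [show (4 : ℕ) = 2 * 2 from rfl, pow_mul, h2]
    norm_num
  have hmul : (zetaOf 20 L ^ 2 + 1) * (zetaOf 20 L ^ 8 - zetaOf 20 L ^ 6 + zetaOf 20 L ^ 4 - zetaOf 20 L ^ 2 + 1) = 0 := by
    linear_combination zetaOf_pow_ten_twenty (L := L)
  exact (mul_eq_zero.1 hmul).resolve_left hne

/-- **`(ζ + ζ³ + ζ⁷ + ζ⁹)² = −5`**: the Gauss period of `{1,3,7,9} ⊂ (ℤ/20)ˣ` is a square root of `−5` in `ℚ(ζ₂₀)`. [cite: Washington1997, Ch. 2]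
[cite: KoblitzRohrlich1978, §1 p. 1184] -/
theorem sq_period_twenty : (zetaOf 20 L + zetaOf 20 L ^ 3 + zetaOf 20 L ^ 7 + zetaOf 20 L ^ 9) ^ 2 = -5 := by
  linear_combination (zetaOf 20 L ^ 8 + 2 * zetaOf 20 L ^ 6 + zetaOf 20 L ^ 4 + 2 * zetaOf 20 L ^ 2 + 4) * zetaOf_pow_ten_twenty (L := L) +
    cyclotomic_relation_twenty (L := L)

/-- Reduction of exponents modulo `20`. [folklore] -/
private theorem zetaOf_pow_add_mul_twenty (q r : ℕ) : zetaOf 20 L ^ (20 * q + r) = zetaOf 20 L ^ r := by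
  rw [pow_add, pow_mul, zetaOf_pow_twenty, one_pow, one_mul]

/-- `σ₃` (`ζ ↦ ζ³`) fixes the period `ζ + ζ³ + ζ⁷ + ζ⁹` (`3·{1,3,7,9} = {3,9,1,7}`). [cite: Washington1997, Thm. 2.5] -/
theorem apply_period_twenty {σ : L ≃ₐ[ℚ] L} (hσ : autResidue 20 L σ = 3) :
    σ (zetaOf 20 L + zetaOf 20 L ^ 3 + zetaOf 20 L ^ 7 + zetaOf 20 L ^ 9) = zetaOf 20 L + zetaOf 20 L ^ 3 + zetaOf 20 L ^ 7 + zetaOf 20 L ^ 9 := by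
  have h := autResidue_spec 20 σ
  rw [map_add, map_add, map_add, map_pow, map_pow, map_pow, h, ← pow_mul, ← pow_mul, ← pow_mul, hσ,
    show (3 : ZMod 20).val = 3 from rfl, show 3 * 3 = 9 from rfl, show 3 * 7 = 20 * 1 + 1 from rfl, show 3 * 9 = 20 * 1 + 7 from rfl,
    zetaOf_pow_add_mul_twenty, zetaOf_pow_add_mul_twenty]
  ring

/-- `W({1,3,7,9}) = {1,3,7,9}` modulo `20` (kernel). [cite: BauerCosteItzyksonRuelle1997, §3.4] -/
theorem stabilizerResidues_twenty :
    ((unitResidues 20).filter fun t => ∀ c ∈ unitResidues 20,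
        (c * t ∈ ({1, 3, 7, 9} : Finset (ZMod 20)) ↔ c ∈ ({1, 3, 7, 9} : Finset (ZMod 20)))) = {1, 3, 7, 9} := by
  decide

/-- **`W = {1,3,7,9}` ⟹ `K₁ = ℚ(√−5) = ℚ(ζ + ζ³ + ζ⁷ + ζ⁹)`** for every CM type of `ℚ(ζ₂₀)` with this stabiliser and ANY primitive sub-pair (`W = ⟨3⟩`
is cyclic, `K₁ = ℚ(ζ₂₀)^{σ₃}` contains the period `δ`, `δ² = −5 < 0`, `[K₁ : ℚ] = 2`). [cite: KoblitzRohrlich1978, §1 p. 1184]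
[cite: BauerCosteItzyksonRuelle1997, §3.3] [cite: Shimura1998, §8.2 Prop. 26] -/
theorem eq_adjoin_period_twenty (Φ : CMType L) {K₁ : IntermediateField ℚ L} (Φ₁ : CMType K₁)
    (h₁ : inducedCMType (algebraMap K₁ L) Φ₁ = Φ)
    (hp₁ : ∀ s t : K₁ →+* ℂ,
      (∀ τ : ℂ ≃+* ℂ, (τ : ℂ →+* ℂ).comp s ∈ Φ₁.1 ↔ (τ : ℂ →+* ℂ).comp t ∈ Φ₁.1) → s = t)
    (hW : ((unitResidues 20).filter fun t =>
        ∀ c ∈ unitResidues 20, (c * t ∈ residueSet 20 Φ ↔ c ∈ residueSet 20 Φ)) = {1, 3, 7, 9}) :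
    zetaOf 20 L + zetaOf 20 L ^ 3 + zetaOf 20 L ^ 7 + zetaOf 20 L ^ 9 ∈ K₁ ∧
      K₁ = IntermediateField.adjoin ℚ {zetaOf 20 L + zetaOf 20 L ^ 3 + zetaOf 20 L ^ 7 + zetaOf 20 L ^ 9} ∧
      (zetaOf 20 L + zetaOf 20 L ^ 3 + zetaOf 20 L ^ 7 + zetaOf 20 L ^ 9) ^ 2 = -5 ∧ Module.finrank ℚ K₁ = 2 := by
  obtain ⟨σ, hσ⟩ := exists_autResidue_eq 20 (L := L) 3 (by decide)
  have hσW : autResidue 20 L σ ∈ ((unitResidues 20).filter fun t =>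
      ∀ c ∈ unitResidues 20, (c * t ∈ residueSet 20 Φ ↔ c ∈ residueSet 20 Φ)) := by
    rw [hW, hσ]; decide
  have hcyc : ∀ t ∈ ((unitResidues 20).filter fun t =>
      ∀ c ∈ unitResidues 20, (c * t ∈ residueSet 20 Φ ↔ c ∈ residueSet 20 Φ)), ∃ k : ℕ, t = autResidue 20 L σ ^ k := by
    intro t ht
    rw [hW] at ht
    rw [hσ]
    simp only [Finset.mem_insert, Finset.mem_singleton] at ht
    rcases ht with rfl | rfl | rfl | rfl
    · exact ⟨0, by decide⟩
    · exact ⟨1, by decide⟩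
    · exact ⟨3, by decide⟩
    · exact ⟨2, by decide⟩
  have hmem := (mem_iff_apply_eq_of_primitive_of_forall_exists_pow (N := 20) Φ Φ₁ h₁ hp₁ hσW hcyc _).2 (apply_period_twenty hσ)
  have hdeg := finrank_eq_two_of_two_mul_card_eq (N := 20) Φ Φ₁ h₁ hp₁ (by rw [hW]; decide)
  exact ⟨hmem, eq_adjoin_of_mem_of_sq_eq_neg hmem (m := 5) (by norm_num) (by rw [sq_period_twenty]; norm_num) hdeg, sq_period_twenty, hdeg⟩

variable {Φ : CMType L} {A : AbelianVariety ℂ} {ι : 𝓞 L →+* End A} {θ : L →+* Module.End ℂ (complexBetti A.X 1)}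

/-- **`N = 20`, `W = {1,3,7,9}`: `A ∼ E⁴` WITH `E` AN ELLIPTIC CURVE WITH COMPLEX MULTIPLICATION BY `𝓞_{ℚ(√−5)}`** (`K₁ = ℚ(ζ+ζ³+ζ⁷+ζ⁹)`,
`(ζ+ζ³+ζ⁷+ζ⁹)² = −5`, `𝓞_{K₁}`-equivariant isogeny onto `E⁴`). [cite: KoblitzRohrlich1978, §1 p. 1184] [cite: BauerCosteItzyksonRuelle1997, §3.3–3.4]
[cite: Shimura1998, §8.2 Prop. 26, §6.2 Thm. 3] -/
theorem exists_isIsogeny_pow_four_elliptic_twenty (hA : IsCMTypeRealisation Φ A ι θ)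
    (hW : ((unitResidues 20).filter fun t =>
        ∀ c ∈ unitResidues 20, (c * t ∈ residueSet 20 Φ ↔ c ∈ residueSet 20 Φ)) = {1, 3, 7, 9}) :
    ∃ (K₁ : IntermediateField ℚ L) (Φ₁ : CMType K₁), IsCMField K₁ ∧ Module.finrank ℚ K₁ = 2 ∧
      zetaOf 20 L + zetaOf 20 L ^ 3 + zetaOf 20 L ^ 7 + zetaOf 20 L ^ 9 ∈ K₁ ∧
      K₁ = IntermediateField.adjoin ℚ {zetaOf 20 L + zetaOf 20 L ^ 3 + zetaOf 20 L ^ 7 + zetaOf 20 L ^ 9} ∧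
      (zetaOf 20 L + zetaOf 20 L ^ 3 + zetaOf 20 L ^ 7 + zetaOf 20 L ^ 9) ^ 2 = -5 ∧
      inducedCMType (algebraMap K₁ L) Φ₁ = Φ ∧
      ∃ (E : AbelianVariety ℂ) (ιE : 𝓞 K₁ →+* End E) (θE : K₁ →+* Module.End ℂ (complexBetti E.X 1)),
        IsCMTypeRealisation Φ₁ E ιE θE ∧ E.IsSimple ∧ E.dim = 1 ∧
        ∃ (h : ℕ) (P : AbelianVariety ℂ) (π : Fin h → (P ⟶ E)), Nonempty (IsLimit (Fan.mk P π)) ∧ h = 4 ∧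
          ∃ g : A ⟶ P, IsIsogeny g ∧
            ∀ (j : Fin h) (b : 𝓞 K₁), ι (RingOfIntegers.mapRingHom (algebraMap K₁ L : K₁ →+* L) b) ≫ (g ≫ π j) = (g ≫ π j) ≫ ιE b := by
  haveI : IsCMField L := IsCyclotomicExtension.Rat.isCMField L (S := {20}) ⟨20, rfl, by norm_num⟩
  have h2W : 2 * ((unitResidues 20).filter fun t =>
      ∀ c ∈ unitResidues 20, (c * t ∈ residueSet 20 Φ ↔ c ∈ residueSet 20 Φ)).card = Nat.totient 20 := by
    rw [hW]; decide
  obtain ⟨K₁, Φ₁, hCM, hK2, h₁, hp₁, -, E, ιE, θE, hE, hs, hdE, h, P, π, hP, -, hhW, -, g, hg, hequiv⟩ :=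
    exists_isIsogeny_power_elliptic_of_two_mul_card_filter (N := 20) hA h2W
  obtain ⟨hmem, hK, hsq, -⟩ := eq_adjoin_period_twenty Φ Φ₁ h₁ hp₁ hW
  have hh4 : h = 4 := by rw [hhW, hW]; decide
  exact ⟨K₁, Φ₁, hCM, hK2, hmem, hK, hsq, h₁, E, ιE, θE, hE, hs, hdE, h, P, π, hP, hh4, g, hg, hequiv⟩

namespace CyclotomicFermatCMType

/-- `H_{1,1,18} = {1, 3, 7, 9}` modulo `20` (Koblitz's level `20`; kernel). [cite: BauerCosteItzyksonRuelle1997, §3.4] -/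
theorem fermatCMType_twenty_one_one_eighteen : fermatCMType 20 1 1 18 = {1, 3, 7, 9} := by decide

/-- **The K–R type `Φ_{H_{1,1,18}}` modulo `20`: every realisation is `∼ E⁴`, `E` elliptic with CM by `𝓞_{ℚ(√−5)}`** (`ℚ(√−5) = ℚ(ζ+ζ³+ζ⁷+ζ⁹)`).
[cite: KoblitzRohrlich1978, §1 p. 1184] [cite: BauerCosteItzyksonRuelle1997, §3.4] -/
theorem exists_isIsogeny_pow_four_elliptic_fermat_twenty
    {hS : ∀ c : ZMod 20, c.val.Coprime 20 → (c ∈ fermatCMType 20 1 1 18 ↔ -c ∉ fermatCMType 20 1 1 18)}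
    {A : AbelianVariety ℂ} {ι : 𝓞 L →+* End A} {θ : L →+* Module.End ℂ (complexBetti A.X 1)}
    (hA : IsCMTypeRealisation (cmTypeOfResidues (L := L) (fermatCMType 20 1 1 18) hS) A ι θ) :
    ∃ (K₁ : IntermediateField ℚ L) (Φ₁ : CMType K₁), IsCMField K₁ ∧ Module.finrank ℚ K₁ = 2 ∧
      zetaOf 20 L + zetaOf 20 L ^ 3 + zetaOf 20 L ^ 7 + zetaOf 20 L ^ 9 ∈ K₁ ∧
      K₁ = IntermediateField.adjoin ℚ {zetaOf 20 L + zetaOf 20 L ^ 3 + zetaOf 20 L ^ 7 + zetaOf 20 L ^ 9} ∧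
      (zetaOf 20 L + zetaOf 20 L ^ 3 + zetaOf 20 L ^ 7 + zetaOf 20 L ^ 9) ^ 2 = -5 ∧
      inducedCMType (algebraMap K₁ L) Φ₁ = cmTypeOfResidues (L := L) (fermatCMType 20 1 1 18) hS ∧
      ∃ (E : AbelianVariety ℂ) (ιE : 𝓞 K₁ →+* End E) (θE : K₁ →+* Module.End ℂ (complexBetti E.X 1)),
        IsCMTypeRealisation Φ₁ E ιE θE ∧ E.IsSimple ∧ E.dim = 1 ∧
        ∃ (h : ℕ) (P : AbelianVariety ℂ) (π : Fin h → (P ⟶ E)), Nonempty (IsLimit (Fan.mk P π)) ∧ h = 4 ∧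
          ∃ g : A ⟶ P, IsIsogeny g ∧
            ∀ (j : Fin h) (b : 𝓞 K₁), ι (RingOfIntegers.mapRingHom (algebraMap K₁ L : K₁ →+* L) b) ≫ (g ≫ π j) = (g ≫ π j) ≫ ιE b := by
  refine exists_isIsogeny_pow_four_elliptic_twenty hA ?_
  rw [residueSet_cmTypeOfResidues 20 (isCMResidueSet_fermatCMType hS), fermatCMType_twenty_one_one_eighteen]
  exact stabilizerResidues_twenty

end CyclotomicFermatCMType

end Twenty

/-! ## §2 `N = 15`: `H = {1, 2, 4, 8}`, `K₁ = ℚ(2(ζ + ζ² + ζ⁴ + ζ⁸) − 1) = ℚ(√−15)` -/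

section Fifteen

variable {L : Type} [Field L] [NumberField L] [IsCyclotomicExtension {15} ℚ L]

/-- `ζ¹⁵ = 1`. [cite: Washington1997, Ch. 2 (roots of unity)] -/
theorem zetaOf_pow_fifteen : zetaOf 15 L ^ 15 = 1 := (IsCyclotomicExtension.zeta_spec 15 ℚ L).pow_eq_one

/-- **`Φ₃(ζ⁵) = ζ¹⁰ + ζ⁵ + 1 = 0` and `Φ₅(ζ³) = ζ¹² + ζ⁹ + ζ⁶ + ζ³ + 1 = 0`** in `ℚ(ζ₁₅)` (`ζ⁵`, `ζ³` are primitive cube resp. fifth roots of unity).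
[cite: Washington1997, Ch. 2 (cyclotomic polynomials)] -/
theorem cyclotomic_relations_fifteen :
    zetaOf 15 L ^ 10 + zetaOf 15 L ^ 5 + 1 = 0 ∧ zetaOf 15 L ^ 12 + zetaOf 15 L ^ 9 + zetaOf 15 L ^ 6 + zetaOf 15 L ^ 3 + 1 = 0 := by
  have hprim : IsPrimitiveRoot (zetaOf 15 L) 15 := IsCyclotomicExtension.zeta_spec 15 ℚ L
  have h5 : zetaOf 15 L ^ 5 ≠ 1 := hprim.pow_ne_one_of_pos_of_lt (by norm_num) (by norm_num)
  have h3 : zetaOf 15 L ^ 3 ≠ 1 := hprim.pow_ne_one_of_pos_of_lt (by norm_num) (by norm_num)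
  constructor
  · have hmul : (zetaOf 15 L ^ 5 - 1) * (zetaOf 15 L ^ 10 + zetaOf 15 L ^ 5 + 1) = 0 := by
      linear_combination zetaOf_pow_fifteen (L := L)
    exact (mul_eq_zero.1 hmul).resolve_left (sub_ne_zero.2 h5)
  · have hmul : (zetaOf 15 L ^ 3 - 1) * (zetaOf 15 L ^ 12 + zetaOf 15 L ^ 9 + zetaOf 15 L ^ 6 + zetaOf 15 L ^ 3 + 1) = 0 := by
      linear_combination zetaOf_pow_fifteen (L := L)
    exact (mul_eq_zero.1 hmul).resolve_left (sub_ne_zero.2 h3)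

/-- **`(2(ζ + ζ² + ζ⁴ + ζ⁸) − 1)² = −15`**: the Gauss period `η` of `{1,2,4,8} = ⟨2⟩ ⊂ (ℤ/15)ˣ` has `η + η̄ = 1`, `(η − η̄)² = −15`, so
`2η − 1 = √−15`. [cite: Washington1997, Ch. 2] [cite: KoblitzRohrlich1978, §1 p. 1184] -/
theorem sq_two_mul_period_sub_one_fifteen : (2 * (zetaOf 15 L + zetaOf 15 L ^ 2 + zetaOf 15 L ^ 4 + zetaOf 15 L ^ 8) - 1) ^ 2 = -15 := by
  obtain ⟨h3, h5⟩ := cyclotomic_relations_fifteen (L := L)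
  linear_combination (4 * zetaOf 15 L) * zetaOf_pow_fifteen (L := L) +
    (8 * zetaOf 15 L ^ 7 + 8 * zetaOf 15 L ^ 6 + 16 * zetaOf 15 L ^ 5 + 24 * zetaOf 15 L ^ 4 + 24 * zetaOf 15 L ^ 3 + 16 * zetaOf 15 L ^ 2 +
      16 * zetaOf 15 L + 16) * h3 +
    (-8 * zetaOf 15 L ^ 5 - 8 * zetaOf 15 L ^ 4 - 16 * zetaOf 15 L ^ 3 - 16 * zetaOf 15 L ^ 2 - 16 * zetaOf 15 L) * h5

/-- Reduction of exponents modulo `15`. [folklore] -/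
private theorem zetaOf_pow_add_mul_fifteen (q r : ℕ) : zetaOf 15 L ^ (15 * q + r) = zetaOf 15 L ^ r := by
  rw [pow_add, pow_mul, zetaOf_pow_fifteen, one_pow, one_mul]

/-- `σ₂` (`ζ ↦ ζ²`) fixes the period `ζ + ζ² + ζ⁴ + ζ⁸` (`2·{1,2,4,8} = {2,4,8,1}`). [cite: Washington1997, Thm. 2.5] -/
theorem apply_period_fifteen {σ : L ≃ₐ[ℚ] L} (hσ : autResidue 15 L σ = 2) :
    σ (zetaOf 15 L + zetaOf 15 L ^ 2 + zetaOf 15 L ^ 4 + zetaOf 15 L ^ 8) = zetaOf 15 L + zetaOf 15 L ^ 2 + zetaOf 15 L ^ 4 + zetaOf 15 L ^ 8 := by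
  have h := autResidue_spec 15 σ
  rw [map_add, map_add, map_add, map_pow, map_pow, map_pow, h, ← pow_mul, ← pow_mul, ← pow_mul, hσ,
    show (2 : ZMod 15).val = 2 from rfl, show 2 * 2 = 4 from rfl, show 2 * 4 = 8 from rfl, show 2 * 8 = 15 * 1 + 1 from rfl,
    zetaOf_pow_add_mul_fifteen]
  ring

/-- `W({1,2,4,8}) = {1,2,4,8}` modulo `15` (kernel). [cite: BauerCosteItzyksonRuelle1997, §3.4] -/
theorem stabilizerResidues_fifteen :
    ((unitResidues 15).filter fun t => ∀ c ∈ unitResidues 15,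
        (c * t ∈ ({1, 2, 4, 8} : Finset (ZMod 15)) ↔ c ∈ ({1, 2, 4, 8} : Finset (ZMod 15)))) = {1, 2, 4, 8} := by
  decide

/-- **`W = {1,2,4,8}` ⟹ `K₁ = ℚ(√−15) = ℚ(2(ζ+ζ²+ζ⁴+ζ⁸) − 1)`** for every CM type of `ℚ(ζ₁₅)` with this stabiliser (`W = ⟨2⟩` cyclic, `K₁ = ℚ(ζ₁₅)^{σ₂}`).
[cite: KoblitzRohrlich1978, §1 p. 1184] [cite: BauerCosteItzyksonRuelle1997, §3.3] [cite: Shimura1998, §8.2 Prop. 26] -/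
theorem eq_adjoin_period_fifteen (Φ : CMType L) {K₁ : IntermediateField ℚ L} (Φ₁ : CMType K₁)
    (h₁ : inducedCMType (algebraMap K₁ L) Φ₁ = Φ)
    (hp₁ : ∀ s t : K₁ →+* ℂ,
      (∀ τ : ℂ ≃+* ℂ, (τ : ℂ →+* ℂ).comp s ∈ Φ₁.1 ↔ (τ : ℂ →+* ℂ).comp t ∈ Φ₁.1) → s = t)
    (hW : ((unitResidues 15).filter fun t =>
        ∀ c ∈ unitResidues 15, (c * t ∈ residueSet 15 Φ ↔ c ∈ residueSet 15 Φ)) = {1, 2, 4, 8}) :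
    2 * (zetaOf 15 L + zetaOf 15 L ^ 2 + zetaOf 15 L ^ 4 + zetaOf 15 L ^ 8) - 1 ∈ K₁ ∧
      K₁ = IntermediateField.adjoin ℚ {2 * (zetaOf 15 L + zetaOf 15 L ^ 2 + zetaOf 15 L ^ 4 + zetaOf 15 L ^ 8) - 1} ∧
      (2 * (zetaOf 15 L + zetaOf 15 L ^ 2 + zetaOf 15 L ^ 4 + zetaOf 15 L ^ 8) - 1) ^ 2 = -15 ∧ Module.finrank ℚ K₁ = 2 := by
  obtain ⟨σ, hσ⟩ := exists_autResidue_eq 15 (L := L) 2 (by decide)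
  have hσW : autResidue 15 L σ ∈ ((unitResidues 15).filter fun t =>
      ∀ c ∈ unitResidues 15, (c * t ∈ residueSet 15 Φ ↔ c ∈ residueSet 15 Φ)) := by
    rw [hW, hσ]; decide
  have hcyc : ∀ t ∈ ((unitResidues 15).filter fun t =>
      ∀ c ∈ unitResidues 15, (c * t ∈ residueSet 15 Φ ↔ c ∈ residueSet 15 Φ)), ∃ k : ℕ, t = autResidue 15 L σ ^ k := by
    intro t ht
    rw [hW] at ht
    rw [hσ]
    simp only [Finset.mem_insert, Finset.mem_singleton] at ht
    rcases ht with rfl | rfl | rfl | rfl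
    · exact ⟨0, by decide⟩
    · exact ⟨1, by decide⟩
    · exact ⟨2, by decide⟩
    · exact ⟨3, by decide⟩
  have hη := (mem_iff_apply_eq_of_primitive_of_forall_exists_pow (N := 15) Φ Φ₁ h₁ hp₁ hσW hcyc _).2 (apply_period_fifteen hσ)
  have h2 : (2 : L) ∈ K₁ := by exact_mod_cast IntermediateField.natCast_mem K₁ 2
  have hmem : 2 * (zetaOf 15 L + zetaOf 15 L ^ 2 + zetaOf 15 L ^ 4 + zetaOf 15 L ^ 8) - 1 ∈ K₁ := sub_mem (mul_mem h2 hη) (one_mem K₁)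
  have hdeg := finrank_eq_two_of_two_mul_card_eq (N := 15) Φ Φ₁ h₁ hp₁ (by rw [hW]; decide)
  exact ⟨hmem, eq_adjoin_of_mem_of_sq_eq_neg hmem (m := 15) (by norm_num) (by rw [sq_two_mul_period_sub_one_fifteen]; norm_num) hdeg,
    sq_two_mul_period_sub_one_fifteen, hdeg⟩

variable {Φ : CMType L} {A : AbelianVariety ℂ} {ι : 𝓞 L →+* End A} {θ : L →+* Module.End ℂ (complexBetti A.X 1)}

/-- **`N = 15`, `W = {1,2,4,8}`: `A ∼ E⁴` WITH `E` AN ELLIPTIC CURVE WITH CM BY `𝓞_{ℚ(√−15)}`** (`K₁ = ℚ(δ)`, `δ = 2(ζ+ζ²+ζ⁴+ζ⁸) − 1`, `δ² = −15`).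
[cite: KoblitzRohrlich1978, §1 p. 1184] [cite: BauerCosteItzyksonRuelle1997, §3.3–3.4] [cite: Shimura1998, §8.2 Prop. 26, §6.2 Thm. 3] -/
theorem exists_isIsogeny_pow_four_elliptic_fifteen (hA : IsCMTypeRealisation Φ A ι θ)
    (hW : ((unitResidues 15).filter fun t =>
        ∀ c ∈ unitResidues 15, (c * t ∈ residueSet 15 Φ ↔ c ∈ residueSet 15 Φ)) = {1, 2, 4, 8}) :
    ∃ (K₁ : IntermediateField ℚ L) (Φ₁ : CMType K₁), IsCMField K₁ ∧ Module.finrank ℚ K₁ = 2 ∧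
      2 * (zetaOf 15 L + zetaOf 15 L ^ 2 + zetaOf 15 L ^ 4 + zetaOf 15 L ^ 8) - 1 ∈ K₁ ∧
      K₁ = IntermediateField.adjoin ℚ {2 * (zetaOf 15 L + zetaOf 15 L ^ 2 + zetaOf 15 L ^ 4 + zetaOf 15 L ^ 8) - 1} ∧
      (2 * (zetaOf 15 L + zetaOf 15 L ^ 2 + zetaOf 15 L ^ 4 + zetaOf 15 L ^ 8) - 1) ^ 2 = -15 ∧
      inducedCMType (algebraMap K₁ L) Φ₁ = Φ ∧
      ∃ (E : AbelianVariety ℂ) (ιE : 𝓞 K₁ →+* End E) (θE : K₁ →+* Module.End ℂ (complexBetti E.X 1)),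
        IsCMTypeRealisation Φ₁ E ιE θE ∧ E.IsSimple ∧ E.dim = 1 ∧
        ∃ (h : ℕ) (P : AbelianVariety ℂ) (π : Fin h → (P ⟶ E)), Nonempty (IsLimit (Fan.mk P π)) ∧ h = 4 ∧
          ∃ g : A ⟶ P, IsIsogeny g ∧
            ∀ (j : Fin h) (b : 𝓞 K₁), ι (RingOfIntegers.mapRingHom (algebraMap K₁ L : K₁ →+* L) b) ≫ (g ≫ π j) = (g ≫ π j) ≫ ιE b := by
  haveI : IsCMField L := IsCyclotomicExtension.Rat.isCMField L (S := {15}) ⟨15, rfl, by norm_num⟩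
  have h2W : 2 * ((unitResidues 15).filter fun t =>
      ∀ c ∈ unitResidues 15, (c * t ∈ residueSet 15 Φ ↔ c ∈ residueSet 15 Φ)).card = Nat.totient 15 := by
    rw [hW]; decide
  obtain ⟨K₁, Φ₁, hCM, hK2, h₁, hp₁, -, E, ιE, θE, hE, hs, hdE, h, P, π, hP, -, hhW, -, g, hg, hequiv⟩ :=
    exists_isIsogeny_power_elliptic_of_two_mul_card_filter (N := 15) hA h2W
  obtain ⟨hmem, hK, hsq, -⟩ := eq_adjoin_period_fifteen Φ Φ₁ h₁ hp₁ hW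
  have hh4 : h = 4 := by rw [hhW, hW]; decide
  exact ⟨K₁, Φ₁, hCM, hK2, hmem, hK, hsq, h₁, E, ιE, θE, hE, hs, hdE, h, P, π, hP, hh4, g, hg, hequiv⟩

namespace CyclotomicFermatCMType

/-- `H_{1,2,12} = {1, 2, 4, 8}` modulo `15` (Koblitz's level `15`; kernel). [cite: BauerCosteItzyksonRuelle1997, §3.4] -/
theorem fermatCMType_fifteen_one_two_twelve : fermatCMType 15 1 2 12 = {1, 2, 4, 8} := by decide

/-- **The K–R type `Φ_{H_{1,2,12}}` modulo `15`: every realisation is `∼ E⁴`, `E` elliptic with CM by `𝓞_{ℚ(√−15)}`.**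
[cite: KoblitzRohrlich1978, §1 p. 1184] [cite: BauerCosteItzyksonRuelle1997, §3.4] -/
theorem exists_isIsogeny_pow_four_elliptic_fermat_fifteen
    {hS : ∀ c : ZMod 15, c.val.Coprime 15 → (c ∈ fermatCMType 15 1 2 12 ↔ -c ∉ fermatCMType 15 1 2 12)}
    {A : AbelianVariety ℂ} {ι : 𝓞 L →+* End A} {θ : L →+* Module.End ℂ (complexBetti A.X 1)}
    (hA : IsCMTypeRealisation (cmTypeOfResidues (L := L) (fermatCMType 15 1 2 12) hS) A ι θ) :
    ∃ (K₁ : IntermediateField ℚ L) (Φ₁ : CMType K₁), IsCMField K₁ ∧ Module.finrank ℚ K₁ = 2 ∧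
      2 * (zetaOf 15 L + zetaOf 15 L ^ 2 + zetaOf 15 L ^ 4 + zetaOf 15 L ^ 8) - 1 ∈ K₁ ∧
      K₁ = IntermediateField.adjoin ℚ {2 * (zetaOf 15 L + zetaOf 15 L ^ 2 + zetaOf 15 L ^ 4 + zetaOf 15 L ^ 8) - 1} ∧
      (2 * (zetaOf 15 L + zetaOf 15 L ^ 2 + zetaOf 15 L ^ 4 + zetaOf 15 L ^ 8) - 1) ^ 2 = -15 ∧
      inducedCMType (algebraMap K₁ L) Φ₁ = cmTypeOfResidues (L := L) (fermatCMType 15 1 2 12) hS ∧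
      ∃ (E : AbelianVariety ℂ) (ιE : 𝓞 K₁ →+* End E) (θE : K₁ →+* Module.End ℂ (complexBetti E.X 1)),
        IsCMTypeRealisation Φ₁ E ιE θE ∧ E.IsSimple ∧ E.dim = 1 ∧
        ∃ (h : ℕ) (P : AbelianVariety ℂ) (π : Fin h → (P ⟶ E)), Nonempty (IsLimit (Fan.mk P π)) ∧ h = 4 ∧
          ∃ g : A ⟶ P, IsIsogeny g ∧
            ∀ (j : Fin h) (b : 𝓞 K₁), ι (RingOfIntegers.mapRingHom (algebraMap K₁ L : K₁ →+* L) b) ≫ (g ≫ π j) = (g ≫ π j) ≫ ιE b := by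
  refine exists_isIsogeny_pow_four_elliptic_fifteen hA ?_
  rw [residueSet_cmTypeOfResidues 15 (isCMResidueSet_fermatCMType hS), fermatCMType_fifteen_one_two_twelve]
  exact stabilizerResidues_fifteen

end CyclotomicFermatCMType

end Fifteen

/-! ## §3 `N = 22`: `H = {1, 3, 5, 9, 15}`, `K₁ = ℚ(2(ζ + ζ³ + ζ⁵ + ζ⁹ + ζ¹⁵) − 1) = ℚ(√−11)` -/

section TwentyTwo

variable {L : Type} [Field L] [NumberField L] [IsCyclotomicExtension {22} ℚ L]

/-- `ζ²² = 1`. [cite: Washington1997, Ch. 2 (roots of unity)] -/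
theorem zetaOf_pow_twentyTwo : zetaOf 22 L ^ 22 = 1 := (IsCyclotomicExtension.zeta_spec 22 ℚ L).pow_eq_one

/-- `ζ¹¹ = −1`. [cite: Washington1997, Ch. 2 (roots of unity)] -/
theorem zetaOf_pow_eleven_twentyTwo : zetaOf 22 L ^ 11 = -1 :=
  ((IsCyclotomicExtension.zeta_spec 22 ℚ L).pow (by norm_num) (show 22 = 11 * 2 by norm_num)).eq_neg_one_of_two_right

/-- **`Φ₁₁(ζ²) = ζ²⁰ + ζ¹⁸ + ⋯ + ζ² + 1 = 0`** in `ℚ(ζ₂₂)` (`ζ²` is a primitive `11`-th root of unity). [cite: Washington1997, Ch. 2 (cyclotomic polynomials)] -/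
theorem cyclotomic_relation_twentyTwo :
    zetaOf 22 L ^ 20 + zetaOf 22 L ^ 18 + zetaOf 22 L ^ 16 + zetaOf 22 L ^ 14 + zetaOf 22 L ^ 12 + zetaOf 22 L ^ 10 + zetaOf 22 L ^ 8 +
      zetaOf 22 L ^ 6 + zetaOf 22 L ^ 4 + zetaOf 22 L ^ 2 + 1 = 0 := by
  have hprim : IsPrimitiveRoot (zetaOf 22 L) 22 := IsCyclotomicExtension.zeta_spec 22 ℚ L
  have h2 : zetaOf 22 L ^ 2 ≠ 1 := hprim.pow_ne_one_of_pos_of_lt (by norm_num) (by norm_num)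
  have hmul : (zetaOf 22 L ^ 2 - 1) * (zetaOf 22 L ^ 20 + zetaOf 22 L ^ 18 + zetaOf 22 L ^ 16 + zetaOf 22 L ^ 14 + zetaOf 22 L ^ 12 +
      zetaOf 22 L ^ 10 + zetaOf 22 L ^ 8 + zetaOf 22 L ^ 6 + zetaOf 22 L ^ 4 + zetaOf 22 L ^ 2 + 1) = 0 := by
    linear_combination zetaOf_pow_twentyTwo (L := L)
  exact (mul_eq_zero.1 hmul).resolve_left (sub_ne_zero.2 h2)

/-- **`(2(ζ + ζ³ + ζ⁵ + ζ⁹ + ζ¹⁵) − 1)² = −11`**: the Gauss period of `{1,3,5,9,15} = ⟨3⟩ ⊂ (ℤ/22)ˣ` gives `√−11`. [cite: Washington1997, Ch. 2]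
[cite: KoblitzRohrlich1978, §1 p. 1184] -/
theorem sq_two_mul_period_sub_one_twentyTwo :
    (2 * (zetaOf 22 L + zetaOf 22 L ^ 3 + zetaOf 22 L ^ 5 + zetaOf 22 L ^ 9 + zetaOf 22 L ^ 15) - 1) ^ 2 = -11 := by
  linear_combination (4 * zetaOf 22 L ^ 19 + 8 * zetaOf 22 L ^ 13 - 4 * zetaOf 22 L ^ 9 - 4 * zetaOf 22 L ^ 8 - 4 * zetaOf 22 L ^ 5 -
      4 * zetaOf 22 L ^ 4 - 4 * zetaOf 22 L ^ 3 - 8 * zetaOf 22 L ^ 2 - 4 * zetaOf 22 L) * zetaOf_pow_eleven_twentyTwo (L := L) +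
    12 * cyclotomic_relation_twentyTwo (L := L)

/-- Reduction of exponents modulo `22`. [folklore] -/
private theorem zetaOf_pow_add_mul_twentyTwo (q r : ℕ) : zetaOf 22 L ^ (22 * q + r) = zetaOf 22 L ^ r := by
  rw [pow_add, pow_mul, zetaOf_pow_twentyTwo, one_pow, one_mul]

/-- `σ₃` fixes the period `ζ + ζ³ + ζ⁵ + ζ⁹ + ζ¹⁵` (`3·{1,3,5,9,15} = {3,9,15,5,1}`). [cite: Washington1997, Thm. 2.5] -/
theorem apply_period_twentyTwo {σ : L ≃ₐ[ℚ] L} (hσ : autResidue 22 L σ = 3) :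
    σ (zetaOf 22 L + zetaOf 22 L ^ 3 + zetaOf 22 L ^ 5 + zetaOf 22 L ^ 9 + zetaOf 22 L ^ 15) =
      zetaOf 22 L + zetaOf 22 L ^ 3 + zetaOf 22 L ^ 5 + zetaOf 22 L ^ 9 + zetaOf 22 L ^ 15 := by
  have h := autResidue_spec 22 σ
  rw [map_add, map_add, map_add, map_add, map_pow, map_pow, map_pow, map_pow, h, ← pow_mul, ← pow_mul, ← pow_mul, ← pow_mul, hσ,
    show (3 : ZMod 22).val = 3 from rfl, show 3 * 3 = 9 from rfl, show 3 * 5 = 15 from rfl, show 3 * 9 = 22 * 1 + 5 from rfl,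
    show 3 * 15 = 22 * 2 + 1 from rfl, zetaOf_pow_add_mul_twentyTwo, zetaOf_pow_add_mul_twentyTwo]
  ring

/-- `W({1,3,5,9,15}) = {1,3,5,9,15}` modulo `22` (kernel). [cite: BauerCosteItzyksonRuelle1997, §3.4] -/
theorem stabilizerResidues_twentyTwo :
    ((unitResidues 22).filter fun t => ∀ c ∈ unitResidues 22,
        (c * t ∈ ({1, 3, 5, 9, 15} : Finset (ZMod 22)) ↔ c ∈ ({1, 3, 5, 9, 15} : Finset (ZMod 22)))) = {1, 3, 5, 9, 15} := by
  decide

/-- **`W = {1,3,5,9,15}` ⟹ `K₁ = ℚ(√−11) = ℚ(2(ζ+ζ³+ζ⁵+ζ⁹+ζ¹⁵) − 1)`** for every CM type of `ℚ(ζ₂₂)` with this stabiliser (`W = ⟨3⟩` cyclic).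
[cite: KoblitzRohrlich1978, §1 p. 1184] [cite: BauerCosteItzyksonRuelle1997, §3.3] [cite: Shimura1998, §8.2 Prop. 26] -/
theorem eq_adjoin_period_twentyTwo (Φ : CMType L) {K₁ : IntermediateField ℚ L} (Φ₁ : CMType K₁)
    (h₁ : inducedCMType (algebraMap K₁ L) Φ₁ = Φ)
    (hp₁ : ∀ s t : K₁ →+* ℂ,
      (∀ τ : ℂ ≃+* ℂ, (τ : ℂ →+* ℂ).comp s ∈ Φ₁.1 ↔ (τ : ℂ →+* ℂ).comp t ∈ Φ₁.1) → s = t)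
    (hW : ((unitResidues 22).filter fun t =>
        ∀ c ∈ unitResidues 22, (c * t ∈ residueSet 22 Φ ↔ c ∈ residueSet 22 Φ)) = {1, 3, 5, 9, 15}) :
    2 * (zetaOf 22 L + zetaOf 22 L ^ 3 + zetaOf 22 L ^ 5 + zetaOf 22 L ^ 9 + zetaOf 22 L ^ 15) - 1 ∈ K₁ ∧
      K₁ = IntermediateField.adjoin ℚ {2 * (zetaOf 22 L + zetaOf 22 L ^ 3 + zetaOf 22 L ^ 5 + zetaOf 22 L ^ 9 + zetaOf 22 L ^ 15) - 1} ∧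
      (2 * (zetaOf 22 L + zetaOf 22 L ^ 3 + zetaOf 22 L ^ 5 + zetaOf 22 L ^ 9 + zetaOf 22 L ^ 15) - 1) ^ 2 = -11 ∧
      Module.finrank ℚ K₁ = 2 := by
  obtain ⟨σ, hσ⟩ := exists_autResidue_eq 22 (L := L) 3 (by decide)
  have hσW : autResidue 22 L σ ∈ ((unitResidues 22).filter fun t =>
      ∀ c ∈ unitResidues 22, (c * t ∈ residueSet 22 Φ ↔ c ∈ residueSet 22 Φ)) := by
    rw [hW, hσ]; decide
  have hcyc : ∀ t ∈ ((unitResidues 22).filter fun t =>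
      ∀ c ∈ unitResidues 22, (c * t ∈ residueSet 22 Φ ↔ c ∈ residueSet 22 Φ)), ∃ k : ℕ, t = autResidue 22 L σ ^ k := by
    intro t ht
    rw [hW] at ht
    rw [hσ]
    simp only [Finset.mem_insert, Finset.mem_singleton] at ht
    rcases ht with rfl | rfl | rfl | rfl | rfl
    · exact ⟨0, by decide⟩
    · exact ⟨1, by decide⟩
    · exact ⟨3, by decide⟩
    · exact ⟨2, by decide⟩
    · exact ⟨4, by decide⟩
  have hη := (mem_iff_apply_eq_of_primitive_of_forall_exists_pow (N := 22) Φ Φ₁ h₁ hp₁ hσW hcyc _).2 (apply_period_twentyTwo hσ)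
  have h2 : (2 : L) ∈ K₁ := by exact_mod_cast IntermediateField.natCast_mem K₁ 2
  have hmem : 2 * (zetaOf 22 L + zetaOf 22 L ^ 3 + zetaOf 22 L ^ 5 + zetaOf 22 L ^ 9 + zetaOf 22 L ^ 15) - 1 ∈ K₁ :=
    sub_mem (mul_mem h2 hη) (one_mem K₁)
  have hdeg := finrank_eq_two_of_two_mul_card_eq (N := 22) Φ Φ₁ h₁ hp₁ (by rw [hW]; decide)
  exact ⟨hmem, eq_adjoin_of_mem_of_sq_eq_neg hmem (m := 11) (by norm_num) (by rw [sq_two_mul_period_sub_one_twentyTwo]; norm_num) hdeg,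
    sq_two_mul_period_sub_one_twentyTwo, hdeg⟩

variable {Φ : CMType L} {A : AbelianVariety ℂ} {ι : 𝓞 L →+* End A} {θ : L →+* Module.End ℂ (complexBetti A.X 1)}

/-- **`N = 22`, `W = {1,3,5,9,15}`: `A ∼ E⁵` WITH `E` AN ELLIPTIC CURVE WITH CM BY `𝓞_{ℚ(√−11)}`** (`K₁ = ℚ(δ)`, `δ² = −11`).
[cite: KoblitzRohrlich1978, §1 p. 1184] [cite: BauerCosteItzyksonRuelle1997, §3.3–3.4] [cite: Shimura1998, §8.2 Prop. 26, §6.2 Thm. 3] -/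
theorem exists_isIsogeny_pow_five_elliptic_twentyTwo (hA : IsCMTypeRealisation Φ A ι θ)
    (hW : ((unitResidues 22).filter fun t =>
        ∀ c ∈ unitResidues 22, (c * t ∈ residueSet 22 Φ ↔ c ∈ residueSet 22 Φ)) = {1, 3, 5, 9, 15}) :
    ∃ (K₁ : IntermediateField ℚ L) (Φ₁ : CMType K₁), IsCMField K₁ ∧ Module.finrank ℚ K₁ = 2 ∧
      2 * (zetaOf 22 L + zetaOf 22 L ^ 3 + zetaOf 22 L ^ 5 + zetaOf 22 L ^ 9 + zetaOf 22 L ^ 15) - 1 ∈ K₁ ∧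
      K₁ = IntermediateField.adjoin ℚ {2 * (zetaOf 22 L + zetaOf 22 L ^ 3 + zetaOf 22 L ^ 5 + zetaOf 22 L ^ 9 + zetaOf 22 L ^ 15) - 1} ∧
      (2 * (zetaOf 22 L + zetaOf 22 L ^ 3 + zetaOf 22 L ^ 5 + zetaOf 22 L ^ 9 + zetaOf 22 L ^ 15) - 1) ^ 2 = -11 ∧
      inducedCMType (algebraMap K₁ L) Φ₁ = Φ ∧
      ∃ (E : AbelianVariety ℂ) (ιE : 𝓞 K₁ →+* End E) (θE : K₁ →+* Module.End ℂ (complexBetti E.X 1)),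
        IsCMTypeRealisation Φ₁ E ιE θE ∧ E.IsSimple ∧ E.dim = 1 ∧
        ∃ (h : ℕ) (P : AbelianVariety ℂ) (π : Fin h → (P ⟶ E)), Nonempty (IsLimit (Fan.mk P π)) ∧ h = 5 ∧
          ∃ g : A ⟶ P, IsIsogeny g ∧
            ∀ (j : Fin h) (b : 𝓞 K₁), ι (RingOfIntegers.mapRingHom (algebraMap K₁ L : K₁ →+* L) b) ≫ (g ≫ π j) = (g ≫ π j) ≫ ιE b := by
  haveI : IsCMField L := IsCyclotomicExtension.Rat.isCMField L (S := {22}) ⟨22, rfl, by norm_num⟩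
  have h2W : 2 * ((unitResidues 22).filter fun t =>
      ∀ c ∈ unitResidues 22, (c * t ∈ residueSet 22 Φ ↔ c ∈ residueSet 22 Φ)).card = Nat.totient 22 := by
    rw [hW]; decide
  obtain ⟨K₁, Φ₁, hCM, hK2, h₁, hp₁, -, E, ιE, θE, hE, hs, hdE, h, P, π, hP, -, hhW, -, g, hg, hequiv⟩ :=
    exists_isIsogeny_power_elliptic_of_two_mul_card_filter (N := 22) hA h2W
  obtain ⟨hmem, hK, hsq, -⟩ := eq_adjoin_period_twentyTwo Φ Φ₁ h₁ hp₁ hW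
  have hh5 : h = 5 := by rw [hhW, hW]; decide
  exact ⟨K₁, Φ₁, hCM, hK2, hmem, hK, hsq, h₁, E, ιE, θE, hE, hs, hdE, h, P, π, hP, hh5, g, hg, hequiv⟩

namespace CyclotomicFermatCMType

/-- `H_{1,3,18} = {1, 3, 5, 9, 15}` modulo `22` (Koblitz's level `22`; kernel). [cite: BauerCosteItzyksonRuelle1997, §3.4] -/
theorem fermatCMType_twentyTwo_one_three_eighteen : fermatCMType 22 1 3 18 = {1, 3, 5, 9, 15} := by decide

/-- **The K–R type `Φ_{H_{1,3,18}}` modulo `22`: every realisation is `∼ E⁵`, `E` elliptic with CM by `𝓞_{ℚ(√−11)}`.**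
[cite: KoblitzRohrlich1978, §1 p. 1184] [cite: BauerCosteItzyksonRuelle1997, §3.4] -/
theorem exists_isIsogeny_pow_five_elliptic_fermat_twentyTwo
    {hS : ∀ c : ZMod 22, c.val.Coprime 22 → (c ∈ fermatCMType 22 1 3 18 ↔ -c ∉ fermatCMType 22 1 3 18)}
    {A : AbelianVariety ℂ} {ι : 𝓞 L →+* End A} {θ : L →+* Module.End ℂ (complexBetti A.X 1)}
    (hA : IsCMTypeRealisation (cmTypeOfResidues (L := L) (fermatCMType 22 1 3 18) hS) A ι θ) :
    ∃ (K₁ : IntermediateField ℚ L) (Φ₁ : CMType K₁), IsCMField K₁ ∧ Module.finrank ℚ K₁ = 2 ∧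
      2 * (zetaOf 22 L + zetaOf 22 L ^ 3 + zetaOf 22 L ^ 5 + zetaOf 22 L ^ 9 + zetaOf 22 L ^ 15) - 1 ∈ K₁ ∧
      K₁ = IntermediateField.adjoin ℚ {2 * (zetaOf 22 L + zetaOf 22 L ^ 3 + zetaOf 22 L ^ 5 + zetaOf 22 L ^ 9 + zetaOf 22 L ^ 15) - 1} ∧
      (2 * (zetaOf 22 L + zetaOf 22 L ^ 3 + zetaOf 22 L ^ 5 + zetaOf 22 L ^ 9 + zetaOf 22 L ^ 15) - 1) ^ 2 = -11 ∧
      inducedCMType (algebraMap K₁ L) Φ₁ = cmTypeOfResidues (L := L) (fermatCMType 22 1 3 18) hS ∧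
      ∃ (E : AbelianVariety ℂ) (ιE : 𝓞 K₁ →+* End E) (θE : K₁ →+* Module.End ℂ (complexBetti E.X 1)),
        IsCMTypeRealisation Φ₁ E ιE θE ∧ E.IsSimple ∧ E.dim = 1 ∧
        ∃ (h : ℕ) (P : AbelianVariety ℂ) (π : Fin h → (P ⟶ E)), Nonempty (IsLimit (Fan.mk P π)) ∧ h = 5 ∧
          ∃ g : A ⟶ P, IsIsogeny g ∧
            ∀ (j : Fin h) (b : 𝓞 K₁), ι (RingOfIntegers.mapRingHom (algebraMap K₁ L : K₁ →+* L) b) ≫ (g ≫ π j) = (g ≫ π j) ≫ ιE b := by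
  refine exists_isIsogeny_pow_five_elliptic_twentyTwo hA ?_
  rw [residueSet_cmTypeOfResidues 22 (isCMResidueSet_fermatCMType hS), fermatCMType_twentyTwo_one_three_eighteen]
  exact stabilizerResidues_twentyTwo

end CyclotomicFermatCMType

end TwentyTwo

/-! ## §4 `N = 39`: `H = ⟨2⟩` of order `12`, `K₁ = ℚ(2η − 1) = ℚ(√−39)` — Koblitz–Rohrlich Remark 2's curve at `39` -/

section ThirtyNine

variable {L : Type} [Field L] [NumberField L] [IsCyclotomicExtension {39} ℚ L]

/-- `ζ³⁹ = 1`. [cite: Washington1997, Ch. 2 (roots of unity)] -/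
theorem zetaOf_pow_thirtyNine : zetaOf 39 L ^ 39 = 1 := (IsCyclotomicExtension.zeta_spec 39 ℚ L).pow_eq_one

/-- **`Φ₃(ζ¹³) = ζ²⁶ + ζ¹³ + 1 = 0` and `Φ₁₃(ζ³) = ζ³⁶ + ζ³³ + ⋯ + ζ³ + 1 = 0`** in `ℚ(ζ₃₉)`. [cite: Washington1997, Ch. 2 (cyclotomic polynomials)] -/
theorem cyclotomic_relations_thirtyNine :
    zetaOf 39 L ^ 26 + zetaOf 39 L ^ 13 + 1 = 0 ∧
      zetaOf 39 L ^ 36 + zetaOf 39 L ^ 33 + zetaOf 39 L ^ 30 + zetaOf 39 L ^ 27 + zetaOf 39 L ^ 24 + zetaOf 39 L ^ 21 + zetaOf 39 L ^ 18 +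
        zetaOf 39 L ^ 15 + zetaOf 39 L ^ 12 + zetaOf 39 L ^ 9 + zetaOf 39 L ^ 6 + zetaOf 39 L ^ 3 + 1 = 0 := by
  have hprim : IsPrimitiveRoot (zetaOf 39 L) 39 := IsCyclotomicExtension.zeta_spec 39 ℚ L
  have h13 : zetaOf 39 L ^ 13 ≠ 1 := hprim.pow_ne_one_of_pos_of_lt (by norm_num) (by norm_num)
  have h3 : zetaOf 39 L ^ 3 ≠ 1 := hprim.pow_ne_one_of_pos_of_lt (by norm_num) (by norm_num)
  constructor
  · have hmul : (zetaOf 39 L ^ 13 - 1) * (zetaOf 39 L ^ 26 + zetaOf 39 L ^ 13 + 1) = 0 := by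
      linear_combination zetaOf_pow_thirtyNine (L := L)
    exact (mul_eq_zero.1 hmul).resolve_left (sub_ne_zero.2 h13)
  · have hmul : (zetaOf 39 L ^ 3 - 1) * (zetaOf 39 L ^ 36 + zetaOf 39 L ^ 33 + zetaOf 39 L ^ 30 + zetaOf 39 L ^ 27 + zetaOf 39 L ^ 24 +
        zetaOf 39 L ^ 21 + zetaOf 39 L ^ 18 + zetaOf 39 L ^ 15 + zetaOf 39 L ^ 12 + zetaOf 39 L ^ 9 + zetaOf 39 L ^ 6 + zetaOf 39 L ^ 3 + 1) =
        0 := by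
      linear_combination zetaOf_pow_thirtyNine (L := L)
    exact (mul_eq_zero.1 hmul).resolve_left (sub_ne_zero.2 h3)

/-- **`(2η − 1)² = −39`** for the Gauss period `η = ζ + ζ² + ζ⁴ + ζ⁵ + ζ⁸ + ζ¹⁰ + ζ¹¹ + ζ¹⁶ + ζ²⁰ + ζ²² + ζ²⁵ + ζ³²` of `H = ⟨2⟩ ⊂ (ℤ/39)ˣ`
(`η + η̄ = μ(39) = 1`, `(η − η̄)² = −39`). [cite: Washington1997, Ch. 2] [cite: KoblitzRohrlich1978, §2 Remark 2] -/
theorem sq_two_mul_period_sub_one_thirtyNine :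
    (2 * (zetaOf 39 L + zetaOf 39 L ^ 2 + zetaOf 39 L ^ 4 + zetaOf 39 L ^ 5 + zetaOf 39 L ^ 8 + zetaOf 39 L ^ 10 + zetaOf 39 L ^ 11 +
        zetaOf 39 L ^ 16 + zetaOf 39 L ^ 20 + zetaOf 39 L ^ 22 + zetaOf 39 L ^ 25 + zetaOf 39 L ^ 32) - 1) ^ 2 = -39 := by
  obtain ⟨h3, h13⟩ := cyclotomic_relations_thirtyNine (L := L)
  linear_combination (4 * zetaOf 39 L ^ 25 + 8 * zetaOf 39 L ^ 18 + 8 * zetaOf 39 L ^ 15 + 8 * zetaOf 39 L ^ 13 + 4 * zetaOf 39 L ^ 11 +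
      8 * zetaOf 39 L ^ 9 + 8 * zetaOf 39 L ^ 8 + 8 * zetaOf 39 L ^ 6 + 4 * zetaOf 39 L ^ 5 + 8 * zetaOf 39 L ^ 4 + 16 * zetaOf 39 L ^ 3 +
      8 * zetaOf 39 L ^ 2 + 12 * zetaOf 39 L) * zetaOf_pow_thirtyNine (L := L) +
    (-8 * zetaOf 39 L ^ 24 - 16 * zetaOf 39 L ^ 23 - 40 * zetaOf 39 L ^ 22 - 48 * zetaOf 39 L ^ 21 - 56 * zetaOf 39 L ^ 20 -
      80 * zetaOf 39 L ^ 19 - 88 * zetaOf 39 L ^ 18 - 96 * zetaOf 39 L ^ 17 - 120 * zetaOf 39 L ^ 16 - 128 * zetaOf 39 L ^ 15 -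
      136 * zetaOf 39 L ^ 14 - 160 * zetaOf 39 L ^ 13 - 176 * zetaOf 39 L ^ 12 - 168 * zetaOf 39 L ^ 11 - 160 * zetaOf 39 L ^ 10 -
      136 * zetaOf 39 L ^ 9 - 128 * zetaOf 39 L ^ 8 - 120 * zetaOf 39 L ^ 7 - 96 * zetaOf 39 L ^ 6 - 88 * zetaOf 39 L ^ 5 -
      80 * zetaOf 39 L ^ 4 - 56 * zetaOf 39 L ^ 3 - 48 * zetaOf 39 L ^ 2 - 40 * zetaOf 39 L) * h3 +
    (8 * zetaOf 39 L ^ 14 + 16 * zetaOf 39 L ^ 13 + 40 * zetaOf 39 L ^ 12 + 40 * zetaOf 39 L ^ 11 + 40 * zetaOf 39 L ^ 10 +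
      40 * zetaOf 39 L ^ 9 + 40 * zetaOf 39 L ^ 8 + 40 * zetaOf 39 L ^ 7 + 40 * zetaOf 39 L ^ 6 + 40 * zetaOf 39 L ^ 5 + 40 * zetaOf 39 L ^ 4 +
      40 * zetaOf 39 L ^ 3 + 56 * zetaOf 39 L ^ 2 + 48 * zetaOf 39 L + 40) * h13

/-- Reduction of exponents modulo `39`. [folklore] -/
private theorem zetaOf_pow_add_thirtyNine (r : ℕ) : zetaOf 39 L ^ (39 + r) = zetaOf 39 L ^ r := by
  rw [pow_add, zetaOf_pow_thirtyNine, one_mul]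

/-- `σ₂` fixes the twelve-term period (`2·H = H`: `2·{20,22,25,32} ≡ {1,5,11,25}`). [cite: Washington1997, Thm. 2.5] -/
theorem apply_period_thirtyNine {σ : L ≃ₐ[ℚ] L} (hσ : autResidue 39 L σ = 2) :
    σ (zetaOf 39 L + zetaOf 39 L ^ 2 + zetaOf 39 L ^ 4 + zetaOf 39 L ^ 5 + zetaOf 39 L ^ 8 + zetaOf 39 L ^ 10 + zetaOf 39 L ^ 11 +
        zetaOf 39 L ^ 16 + zetaOf 39 L ^ 20 + zetaOf 39 L ^ 22 + zetaOf 39 L ^ 25 + zetaOf 39 L ^ 32) =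
      zetaOf 39 L + zetaOf 39 L ^ 2 + zetaOf 39 L ^ 4 + zetaOf 39 L ^ 5 + zetaOf 39 L ^ 8 + zetaOf 39 L ^ 10 + zetaOf 39 L ^ 11 +
        zetaOf 39 L ^ 16 + zetaOf 39 L ^ 20 + zetaOf 39 L ^ 22 + zetaOf 39 L ^ 25 + zetaOf 39 L ^ 32 := by
  have h := autResidue_spec 39 σ
  rw [hσ, show (2 : ZMod 39).val = 2 from rfl] at h
  simp only [map_add, map_pow, h, ← pow_mul]
  rw [show 2 * 20 = 39 + 1 from rfl, show 2 * 22 = 39 + 5 from rfl, show 2 * 25 = 39 + 11 from rfl, show 2 * 32 = 39 + 25 from rfl,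
    zetaOf_pow_add_thirtyNine, zetaOf_pow_add_thirtyNine, zetaOf_pow_add_thirtyNine, zetaOf_pow_add_thirtyNine]
  ring

/-- `W(H) = H` for `H = {1,2,4,5,8,10,11,16,20,22,25,32}` modulo `39` (kernel; the sibling's `filter_stabilizer_eq_fermatCMType_thirtyNine` in
explicit form). [cite: KoblitzRohrlich1978, §2 Remark 2] -/
theorem stabilizerResidues_thirtyNine :
    ((unitResidues 39).filter fun t => ∀ c ∈ unitResidues 39,
        (c * t ∈ ({1, 2, 4, 5, 8, 10, 11, 16, 20, 22, 25, 32} : Finset (ZMod 39)) ↔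
          c ∈ ({1, 2, 4, 5, 8, 10, 11, 16, 20, 22, 25, 32} : Finset (ZMod 39)))) = {1, 2, 4, 5, 8, 10, 11, 16, 20, 22, 25, 32} := by
  decide

/-- **`W = H` ⟹ `K₁ = ℚ(√−39) = ℚ(2η − 1)`** for every CM type of `ℚ(ζ₃₉)` with stabiliser `H = ⟨2⟩` (cyclic of order `12`; `K₁ = ℚ(ζ₃₉)^{σ₂}`).
[cite: KoblitzRohrlich1978, §1 p. 1184, §2 Remark 2] [cite: BauerCosteItzyksonRuelle1997, §3.3] [cite: Shimura1998, §8.2 Prop. 26] -/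
theorem eq_adjoin_period_thirtyNine (Φ : CMType L) {K₁ : IntermediateField ℚ L} (Φ₁ : CMType K₁)
    (h₁ : inducedCMType (algebraMap K₁ L) Φ₁ = Φ)
    (hp₁ : ∀ s t : K₁ →+* ℂ,
      (∀ τ : ℂ ≃+* ℂ, (τ : ℂ →+* ℂ).comp s ∈ Φ₁.1 ↔ (τ : ℂ →+* ℂ).comp t ∈ Φ₁.1) → s = t)
    (hW : ((unitResidues 39).filter fun t =>
        ∀ c ∈ unitResidues 39, (c * t ∈ residueSet 39 Φ ↔ c ∈ residueSet 39 Φ)) = {1, 2, 4, 5, 8, 10, 11, 16, 20, 22, 25, 32}) :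
    2 * (zetaOf 39 L + zetaOf 39 L ^ 2 + zetaOf 39 L ^ 4 + zetaOf 39 L ^ 5 + zetaOf 39 L ^ 8 + zetaOf 39 L ^ 10 + zetaOf 39 L ^ 11 +
        zetaOf 39 L ^ 16 + zetaOf 39 L ^ 20 + zetaOf 39 L ^ 22 + zetaOf 39 L ^ 25 + zetaOf 39 L ^ 32) - 1 ∈ K₁ ∧
      K₁ = IntermediateField.adjoin ℚ {2 * (zetaOf 39 L + zetaOf 39 L ^ 2 + zetaOf 39 L ^ 4 + zetaOf 39 L ^ 5 + zetaOf 39 L ^ 8 +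
        zetaOf 39 L ^ 10 + zetaOf 39 L ^ 11 + zetaOf 39 L ^ 16 + zetaOf 39 L ^ 20 + zetaOf 39 L ^ 22 + zetaOf 39 L ^ 25 + zetaOf 39 L ^ 32) - 1} ∧
      (2 * (zetaOf 39 L + zetaOf 39 L ^ 2 + zetaOf 39 L ^ 4 + zetaOf 39 L ^ 5 + zetaOf 39 L ^ 8 + zetaOf 39 L ^ 10 + zetaOf 39 L ^ 11 +
        zetaOf 39 L ^ 16 + zetaOf 39 L ^ 20 + zetaOf 39 L ^ 22 + zetaOf 39 L ^ 25 + zetaOf 39 L ^ 32) - 1) ^ 2 = -39 ∧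
      Module.finrank ℚ K₁ = 2 := by
  obtain ⟨σ, hσ⟩ := exists_autResidue_eq 39 (L := L) 2 (by decide)
  have hσW : autResidue 39 L σ ∈ ((unitResidues 39).filter fun t =>
      ∀ c ∈ unitResidues 39, (c * t ∈ residueSet 39 Φ ↔ c ∈ residueSet 39 Φ)) := by
    rw [hW, hσ]; decide
  have hcyc : ∀ t ∈ ((unitResidues 39).filter fun t =>
      ∀ c ∈ unitResidues 39, (c * t ∈ residueSet 39 Φ ↔ c ∈ residueSet 39 Φ)), ∃ k : ℕ, t = autResidue 39 L σ ^ k := by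
    intro t ht
    rw [hW] at ht
    rw [hσ]
    simp only [Finset.mem_insert, Finset.mem_singleton] at ht
    rcases ht with rfl | rfl | rfl | rfl | rfl | rfl | rfl | rfl | rfl | rfl | rfl | rfl
    · exact ⟨0, by decide⟩
    · exact ⟨1, by decide⟩
    · exact ⟨2, by decide⟩
    · exact ⟨9, by decide⟩
    · exact ⟨3, by decide⟩
    · exact ⟨10, by decide⟩
    · exact ⟨7, by decide⟩
    · exact ⟨4, by decide⟩
    · exact ⟨11, by decide⟩
    · exact ⟨8, by decide⟩
    · exact ⟨6, by decide⟩
    · exact ⟨5, by decide⟩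
  have hη := (mem_iff_apply_eq_of_primitive_of_forall_exists_pow (N := 39) Φ Φ₁ h₁ hp₁ hσW hcyc _).2 (apply_period_thirtyNine hσ)
  have h2 : (2 : L) ∈ K₁ := by exact_mod_cast IntermediateField.natCast_mem K₁ 2
  have hmem := sub_mem (mul_mem h2 hη) (one_mem K₁)
  have hdeg := finrank_eq_two_of_two_mul_card_eq (N := 39) Φ Φ₁ h₁ hp₁ (by rw [hW]; decide)
  exact ⟨hmem, eq_adjoin_of_mem_of_sq_eq_neg hmem (m := 39) (by norm_num) (by rw [sq_two_mul_period_sub_one_thirtyNine]; norm_num) hdeg,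
    sq_two_mul_period_sub_one_thirtyNine, hdeg⟩

variable {Φ : CMType L} {A : AbelianVariety ℂ} {ι : 𝓞 L →+* End A} {θ : L →+* Module.End ℂ (complexBetti A.X 1)}

/-- **`N = 39`, `W = ⟨2⟩`: `A ∼ E¹²` WITH `E` AN ELLIPTIC CURVE WITH COMPLEX MULTIPLICATION BY `𝓞_{ℚ(√−39)}`** (`K₁ = ℚ(2η − 1)`,
`(2η − 1)² = −39`) — Koblitz–Rohrlich's «product of `12` copies of an elliptic curve that does not occur as a simple factor for prime `N`», the
curve's CM field identified. [cite: KoblitzRohrlich1978, §2 Remark 2, §1 p. 1184] [cite: BauerCosteItzyksonRuelle1997, §3.3–3.4]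
[cite: Shimura1998, §8.2 Prop. 26, §6.2 Thm. 3] -/
theorem exists_isIsogeny_pow_twelve_elliptic_sqrt_neg_thirtyNine (hA : IsCMTypeRealisation Φ A ι θ)
    (hW : ((unitResidues 39).filter fun t =>
        ∀ c ∈ unitResidues 39, (c * t ∈ residueSet 39 Φ ↔ c ∈ residueSet 39 Φ)) = {1, 2, 4, 5, 8, 10, 11, 16, 20, 22, 25, 32}) :
    ∃ (K₁ : IntermediateField ℚ L) (Φ₁ : CMType K₁), IsCMField K₁ ∧ Module.finrank ℚ K₁ = 2 ∧
      2 * (zetaOf 39 L + zetaOf 39 L ^ 2 + zetaOf 39 L ^ 4 + zetaOf 39 L ^ 5 + zetaOf 39 L ^ 8 + zetaOf 39 L ^ 10 + zetaOf 39 L ^ 11 +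
        zetaOf 39 L ^ 16 + zetaOf 39 L ^ 20 + zetaOf 39 L ^ 22 + zetaOf 39 L ^ 25 + zetaOf 39 L ^ 32) - 1 ∈ K₁ ∧
      K₁ = IntermediateField.adjoin ℚ {2 * (zetaOf 39 L + zetaOf 39 L ^ 2 + zetaOf 39 L ^ 4 + zetaOf 39 L ^ 5 + zetaOf 39 L ^ 8 +
        zetaOf 39 L ^ 10 + zetaOf 39 L ^ 11 + zetaOf 39 L ^ 16 + zetaOf 39 L ^ 20 + zetaOf 39 L ^ 22 + zetaOf 39 L ^ 25 + zetaOf 39 L ^ 32) - 1} ∧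
      (2 * (zetaOf 39 L + zetaOf 39 L ^ 2 + zetaOf 39 L ^ 4 + zetaOf 39 L ^ 5 + zetaOf 39 L ^ 8 + zetaOf 39 L ^ 10 + zetaOf 39 L ^ 11 +
        zetaOf 39 L ^ 16 + zetaOf 39 L ^ 20 + zetaOf 39 L ^ 22 + zetaOf 39 L ^ 25 + zetaOf 39 L ^ 32) - 1) ^ 2 = -39 ∧
      inducedCMType (algebraMap K₁ L) Φ₁ = Φ ∧
      ∃ (E : AbelianVariety ℂ) (ιE : 𝓞 K₁ →+* End E) (θE : K₁ →+* Module.End ℂ (complexBetti E.X 1)),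
        IsCMTypeRealisation Φ₁ E ιE θE ∧ E.IsSimple ∧ E.dim = 1 ∧
        ∃ (h : ℕ) (P : AbelianVariety ℂ) (π : Fin h → (P ⟶ E)), Nonempty (IsLimit (Fan.mk P π)) ∧ h = 12 ∧
          ∃ g : A ⟶ P, IsIsogeny g ∧
            ∀ (j : Fin h) (b : 𝓞 K₁), ι (RingOfIntegers.mapRingHom (algebraMap K₁ L : K₁ →+* L) b) ≫ (g ≫ π j) = (g ≫ π j) ≫ ιE b := by
  haveI : IsCMField L := IsCyclotomicExtension.Rat.isCMField L (S := {39}) ⟨39, rfl, by norm_num⟩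
  have h2W : 2 * ((unitResidues 39).filter fun t =>
      ∀ c ∈ unitResidues 39, (c * t ∈ residueSet 39 Φ ↔ c ∈ residueSet 39 Φ)).card = Nat.totient 39 := by
    rw [hW]; decide
  obtain ⟨K₁, Φ₁, hCM, hK2, h₁, hp₁, -, E, ιE, θE, hE, hs, hdE, h, P, π, hP, -, hhW, -, g, hg, hequiv⟩ :=
    exists_isIsogeny_power_elliptic_of_two_mul_card_filter (N := 39) hA h2W
  obtain ⟨hmem, hK, hsq, -⟩ := eq_adjoin_period_thirtyNine Φ Φ₁ h₁ hp₁ hW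
  have hh : h = 12 := by rw [hhW, hW]; decide
  exact ⟨K₁, Φ₁, hCM, hK2, hmem, hK, hsq, h₁, E, ιE, θE, hE, hs, hdE, h, P, π, hP, hh, g, hg, hequiv⟩

namespace CyclotomicFermatCMType

-- `H_{1,16,22} = {1,2,4,5,8,10,11,16,20,22,25,32}` modulo `39` is the sibling's `fermatCMType_thirtyNine_one_sixteen_twentyTwo`
-- (`CyclotomicFermatCMTypesOddTwoPrimeLevelExceptional`, K–R Remark 2's triple `(1, ρ, ρ²)`, `ρ = 16`), reused below.

/-- **K–R Remark 2 at `39` WITH THE FIELD: every abelian variety of type `Φ_{H_{1,16,22}}` is `∼ E¹²`, `E` an elliptic curve with complex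
multiplication by `𝓞_{ℚ(√−39)}`** (`ℚ(√−39) = ℚ(2η − 1) ⊂ ℚ(ζ₃₉)`). [cite: KoblitzRohrlich1978, §2 Remark 2] [cite: BauerCosteItzyksonRuelle1997, §3.4] -/
theorem exists_isIsogeny_pow_twelve_elliptic_fermat_thirtyNine
    {hS : ∀ c : ZMod 39, c.val.Coprime 39 → (c ∈ fermatCMType 39 1 16 22 ↔ -c ∉ fermatCMType 39 1 16 22)}
    {A : AbelianVariety ℂ} {ι : 𝓞 L →+* End A} {θ : L →+* Module.End ℂ (complexBetti A.X 1)}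
    (hA : IsCMTypeRealisation (cmTypeOfResidues (L := L) (fermatCMType 39 1 16 22) hS) A ι θ) :
    ∃ (K₁ : IntermediateField ℚ L) (Φ₁ : CMType K₁), IsCMField K₁ ∧ Module.finrank ℚ K₁ = 2 ∧
      2 * (zetaOf 39 L + zetaOf 39 L ^ 2 + zetaOf 39 L ^ 4 + zetaOf 39 L ^ 5 + zetaOf 39 L ^ 8 + zetaOf 39 L ^ 10 + zetaOf 39 L ^ 11 +
        zetaOf 39 L ^ 16 + zetaOf 39 L ^ 20 + zetaOf 39 L ^ 22 + zetaOf 39 L ^ 25 + zetaOf 39 L ^ 32) - 1 ∈ K₁ ∧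
      K₁ = IntermediateField.adjoin ℚ {2 * (zetaOf 39 L + zetaOf 39 L ^ 2 + zetaOf 39 L ^ 4 + zetaOf 39 L ^ 5 + zetaOf 39 L ^ 8 +
        zetaOf 39 L ^ 10 + zetaOf 39 L ^ 11 + zetaOf 39 L ^ 16 + zetaOf 39 L ^ 20 + zetaOf 39 L ^ 22 + zetaOf 39 L ^ 25 + zetaOf 39 L ^ 32) - 1} ∧
      (2 * (zetaOf 39 L + zetaOf 39 L ^ 2 + zetaOf 39 L ^ 4 + zetaOf 39 L ^ 5 + zetaOf 39 L ^ 8 + zetaOf 39 L ^ 10 + zetaOf 39 L ^ 11 +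
        zetaOf 39 L ^ 16 + zetaOf 39 L ^ 20 + zetaOf 39 L ^ 22 + zetaOf 39 L ^ 25 + zetaOf 39 L ^ 32) - 1) ^ 2 = -39 ∧
      inducedCMType (algebraMap K₁ L) Φ₁ = cmTypeOfResidues (L := L) (fermatCMType 39 1 16 22) hS ∧
      ∃ (E : AbelianVariety ℂ) (ιE : 𝓞 K₁ →+* End E) (θE : K₁ →+* Module.End ℂ (complexBetti E.X 1)),
        IsCMTypeRealisation Φ₁ E ιE θE ∧ E.IsSimple ∧ E.dim = 1 ∧
        ∃ (h : ℕ) (P : AbelianVariety ℂ) (π : Fin h → (P ⟶ E)), Nonempty (IsLimit (Fan.mk P π)) ∧ h = 12 ∧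
          ∃ g : A ⟶ P, IsIsogeny g ∧
            ∀ (j : Fin h) (b : 𝓞 K₁), ι (RingOfIntegers.mapRingHom (algebraMap K₁ L : K₁ →+* L) b) ≫ (g ≫ π j) = (g ≫ π j) ≫ ιE b := by
  refine exists_isIsogeny_pow_twelve_elliptic_sqrt_neg_thirtyNine hA ?_
  rw [residueSet_cmTypeOfResidues 39 (isCMResidueSet_fermatCMType hS), fermatCMType_thirtyNine_one_sixteen_twentyTwo]
  exact stabilizerResidues_thirtyNine

end CyclotomicFermatCMType

end ThirtyNine

end Literature.AlgebraicGeometry.ComplexMultiplication
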